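import Literature.MathematicalPhysics.QuantumFieldTheory.Balaban1983to89.Beta.EntrywiseVolumeLimit

/-!
# [Balaban1987RG1] (5.10) p. 293 shape for COMPOSITE kernels: two-variable exponential decay `Decay₂` is preserved by
# sums, scalars and composition of ℤ^d kernels — so the (182)-composite kernel decays when its pieces do
# (`Beta.RemainderKernelDecay`)

statement-level skeleton of published theorems with citation tags; proofs where landed; nothing here is a claim
about the Yang–Mills mass gap.

HONEST FRAMING (cell rule).  Bookkeeping for the k-uniform remainder chain of row (D4) (`RemainderConst` ⇐ ONE
`ChainTFac190` instance, `Beta.RemainderDecay190`); discharges NOTHING of `BetaPertH`; NOT B12 Thm 2, NOT the continuum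
limit, NOT Clay.  Unit `b2b-balaban-beta-an4` gen 95 (BINDER row D4 OWNER; cell pub-balaban).  Imports
`Beta.EntrywiseVolumeLimit` (this lineage gen 9: `Kernel₂`, `Decay₂`, `compKer`; carrying pv04 ∕ an4's
`Beta.VolumeConvolution`: `decay510_latticeConv`) ONLY; nothing edited.

WHAT.  NODE E of row (D4) consumes, with the periodisation letter `hker`, the DECAY letter `hdec : Decay₂ (S Y) C δ` of
the ℤ^d kernel whose periodisation is (δ𝐇∕δB)_n (generation 94's `hconv_restrictCLM_of_periodised`; generation 95's
`RemainderKernelPeriodised.entry_eq182` supplies `hker` for the (182)-COMPOSITE `(a₀ + h₀) − h ∘ 𝔡 ∘ (a₀ + h₀)` of periodised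
pieces).  THIS FILE supplies the decay of such composites from the decay of the pieces: `decay₂_add`, `decay₂_smul`,
`decay₂_mono` and **`decay₂_compKer`** (`|Σ_z T(x,z)S(z,y)| ≤ C₁C₂(Σ_w e^{−(δ₂−δ′)|w|₁})·e^{−δ′|x−y|₁}` for
`0 ≤ δ′ ≤ δ₁`, `δ′ < δ₂` — the two-variable reading of `decay510_latticeConv`: dominate by the convolution of the radial
majorants, re-indexed at the base point `y`), and the packaged **`decay₂_eq182`** for the (182)-composite kernel at any
rate `δ′` below the pieces' rates.  WHAT IS *NOT* DONE: nothing of Bałaban's is constructed or asserted; the rates and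
constants of HIS kernels are NODE O's; row D4 class UNCHANGED (instance 0∕1; critical-path width 0 = NODE O; D4 DISCHARGE
NO DATE).  No `def`, no named fact, no `sorry`, standard axioms.
HONEST DEPENDENCY: continuum YM on T⁴ ⇐ BetaPertH ∧ nine spine estimates (0/9 proved); BetaPertH ⇐ (D1) ∧ (D4) ∧
CAP+tail; G-an2-4 gates asym, D1 and NE2/3/4.

Sources: [I] = T. Bałaban, Commun. Math. Phys. **109** (1987) 249–301 [Balaban1987RG1], (5.10) p. 293; [15] = T. Bałaban,
Commun. Math. Phys. **102** (1985) 277–309 [Balaban1985Variational], (182) p. 307, (2.61)-type row sums via [3]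
[Balaban1984PropagatorsII] p. 234.
-/

namespace Literature.MathematicalPhysics.QuantumFieldTheory.Balaban1983to89.Beta.RemainderKernelDecay

open Literature.MathematicalPhysics.QuantumFieldTheory.Balaban1983to89
open Literature.MathematicalPhysics.QuantumFieldTheory.Balaban1983to89.B12Sec2to5 (l1 l1_nonneg Decay510 summable_exp_neg_l1)
open Literature.MathematicalPhysics.QuantumFieldTheory.Balaban1983to89.Beta
  (Kernel₂ Decay₂ compKer decay510_latticeConv summable_abs_latticeConv_term abs_latticeConv_term_le)

variable {d : ℕ} {T S : Kernel₂ d} {C C₁ C₂ δ δ₁ δ₂ δ' : ℝ}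

/-- Decay constants add under sums of kernels (common rate). [cite: Balaban1987RG1, (5.10) p.293] -/
theorem decay₂_add (hT : Decay₂ T C₁ δ) (hS : Decay₂ S C₂ δ) : Decay₂ (T + S) (C₁ + C₂) δ := fun x y => by
  rw [Pi.add_apply, Pi.add_apply, add_mul]
  exact (abs_add_le _ _).trans (add_le_add (hT x y) (hS x y))

/-- Decay constants scale. [cite: Balaban1987RG1, (5.10) p.293] -/
theorem decay₂_smul (hT : Decay₂ T C δ) (c : ℝ) : Decay₂ (fun x y => c * T x y) (|c| * C) δ := fun x y => by
  rw [abs_mul, mul_assoc]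
  exact mul_le_mul_of_nonneg_left (hT x y) (abs_nonneg c)

/-- Decay at a rate persists at every smaller rate (constant unchanged). [cite: Balaban1987RG1, (5.10) p.293] -/
theorem decay₂_mono (hT : Decay₂ T C δ) (hδ' : δ' ≤ δ) : Decay₂ T C δ' := fun x y =>
  (hT x y).trans (mul_le_mul_of_nonneg_left
    (Real.exp_le_exp.mpr (by nlinarith [l1_nonneg (x - y)])) hT.constant_nonneg)

/-- **TWO-VARIABLE DECAY IS PRESERVED BY COMPOSITION**: if `|T(x,z)| ≤ C₁e^{−δ₁|x−z|₁}` and `|S(z,y)| ≤ C₂e^{−δ₂|z−y|₁}`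
then for `0 ≤ δ′ ≤ δ₁`, `δ′ < δ₂`: `|(T ∘ S)(x,y)| ≤ C₁C₂(Σ_w e^{−(δ₂−δ′)|w|₁})·e^{−δ′|x−y|₁}` — dominate the composition
series by the ℤ^d convolution of the radial majorants based at `y` and use `decay510_latticeConv`.
[cite: Balaban1987RG1, (5.10) p.293; Balaban1984PropagatorsII, (2.61) p.234] -/
theorem decay₂_compKer (hT : Decay₂ T C₁ δ₁) (hS : Decay₂ S C₂ δ₂) (hδ'0 : 0 ≤ δ') (hδ'1 : δ' ≤ δ₁)
    (hδ'2 : δ' < δ₂) :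
    Decay₂ (compKer T S) (C₁ * C₂ * ∑' w : Fin d → ℤ, Real.exp (-(δ₂ - δ') * l1 w)) δ' := by
  intro x y
  have hC₁ : 0 ≤ C₁ := hT.constant_nonneg
  have hC₂ : 0 ≤ C₂ := hS.constant_nonneg
  -- radial majorants, as one-variable (5.10)-kernels
  have hF : Decay510 (fun w : Fin d → ℤ => C₁ * Real.exp (-δ₁ * l1 w)) C₁ δ₁ := fun w => by
    rw [abs_of_nonneg (by positivity)]
  have hV : Decay510 (fun w : Fin d → ℤ => C₂ * Real.exp (-δ₂ * l1 w)) C₂ δ₂ := fun w => by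
    rw [abs_of_nonneg (by positivity)]
  have hconv := decay510_latticeConv hF hV hδ'0 hδ'1 hδ'2 (x - y)
  -- the composition series at (x, y), re-indexed by `z = y + w`, is dominated termwise by the convolution series
  have hdom : ∀ w : Fin d → ℤ, |T x (y + w) * S (y + w) y| ≤
      (C₁ * Real.exp (-δ₁ * l1 (x - y - w))) * (C₂ * Real.exp (-δ₂ * l1 w)) := fun w => by
    rw [abs_mul]
    refine mul_le_mul ?_ ?_ (abs_nonneg _) (by positivity)
    · have := hT x (y + w); rwa [show x - (y + w) = x - y - w by abel] at this
    · have := hS (y + w) y; rwa [show y + w - y = w by abel] at this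
  have hsum : Summable fun w : Fin d → ℤ =>
      (C₁ * Real.exp (-δ₁ * l1 (x - y - w))) * (C₂ * Real.exp (-δ₂ * l1 w)) := by
    have h := summable_abs_latticeConv_term hF hV hδ'0 hδ'1 hδ'2 (x - y)
    refine h.congr fun w => ?_
    exact abs_of_nonneg (by positivity)
  have hsabs : Summable fun w : Fin d → ℤ => |T x (y + w) * S (y + w) y| :=
    Summable.of_nonneg_of_le (fun _ => abs_nonneg _) hdom hsum
  have hs : Summable fun w : Fin d → ℤ => T x (y + w) * S (y + w) y :=
    Summable.of_norm (by simpa only [Real.norm_eq_abs] using hsabs)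
  -- re-index the composition series
  have hre : compKer T S x y = ∑' w : Fin d → ℤ, T x (y + w) * S (y + w) y := by
    unfold compKer
    rw [← (Equiv.addLeft y).tsum_eq]
    rfl
  rw [hre]
  calc |∑' w : Fin d → ℤ, T x (y + w) * S (y + w) y|
      ≤ ∑' w : Fin d → ℤ, |T x (y + w) * S (y + w) y| := by
        have h := norm_tsum_le_tsum_norm hs.norm
        simpa only [Real.norm_eq_abs] using h
    _ ≤ ∑' w : Fin d → ℤ, (C₁ * Real.exp (-δ₁ * l1 (x - y - w))) * (C₂ * Real.exp (-δ₂ * l1 w)) :=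
        hsabs.tsum_le_tsum hdom hsum
    _ = Beta.latticeConv (fun w : Fin d → ℤ => C₁ * Real.exp (-δ₁ * l1 w))
          (fun w : Fin d → ℤ => C₂ * Real.exp (-δ₂ * l1 w)) (x - y) := rfl
    _ ≤ |Beta.latticeConv (fun w : Fin d → ℤ => C₁ * Real.exp (-δ₁ * l1 w))
          (fun w : Fin d → ℤ => C₂ * Real.exp (-δ₂ * l1 w)) (x - y)| := le_abs_self _
    _ ≤ _ := hconv

/-- **THE (182)-COMPOSITE KERNEL DECAYS**: if `a₀`, `h₀`, `h`, `𝔡` decay at a common rate `δ₀ > 0` (constants `Ca`,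
`Ch₀`, `Ch`, `Cd`; a common rate is no loss — `decay₂_mono`), then the kernel
`k₁₈₂ := (a₀ + h₀) + (−1)·(h ∘ (𝔡 ∘ (a₀ + h₀)))` of `RemainderKernelPeriodised.entry_eq182` obeys `Decay₂ k₁₈₂ C′ (δ₀∕4)`
with the explicit constant below (each composition spends half the current rate on the row sum, [3] (2.61)-style) —
NODE E's `hdec` for the composite from the pieces' decay. [cite: Balaban1985Variational, (182) p.307; Balaban1987RG1, (5.10) p.293; Balaban1984PropagatorsII, (2.61) p.234] -/
theorem decay₂_eq182 {a₀ h₀ h 𝔡 : Kernel₂ d} {Ca Ch₀ Ch Cd δ₀ : ℝ}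
    (ha : Decay₂ a₀ Ca δ₀) (hh₀ : Decay₂ h₀ Ch₀ δ₀) (hh : Decay₂ h Ch δ₀) (hd : Decay₂ 𝔡 Cd δ₀) (hδ₀ : 0 < δ₀) :
    Decay₂ ((a₀ + h₀) + fun x y => (-1) * compKer h (compKer 𝔡 (a₀ + h₀)) x y)
      ((Ca + Ch₀) + |(-1 : ℝ)| *
        (Ch * (Cd * (Ca + Ch₀) * ∑' w : Fin d → ℤ, Real.exp (-(δ₀ - δ₀ / 2) * l1 w)) *
          ∑' w : Fin d → ℤ, Real.exp (-(δ₀ / 2 - δ₀ / 4) * l1 w)))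
      (δ₀ / 4) := by
  have p1 : Decay₂ (a₀ + h₀) (Ca + Ch₀) δ₀ := decay₂_add ha hh₀
  have p2 : Decay₂ (compKer 𝔡 (a₀ + h₀)) (Cd * (Ca + Ch₀) * ∑' w : Fin d → ℤ, Real.exp (-(δ₀ - δ₀ / 2) * l1 w))
      (δ₀ / 2) :=
    decay₂_compKer hd p1 (by linarith) (by linarith) (by linarith)
  have p3 : Decay₂ (compKer h (compKer 𝔡 (a₀ + h₀)))
      (Ch * (Cd * (Ca + Ch₀) * ∑' w : Fin d → ℤ, Real.exp (-(δ₀ - δ₀ / 2) * l1 w)) *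
        ∑' w : Fin d → ℤ, Real.exp (-(δ₀ / 2 - δ₀ / 4) * l1 w)) (δ₀ / 4) :=
    decay₂_compKer hh p2 (by linarith) (by linarith) (by linarith)
  exact decay₂_add (decay₂_mono p1 (by linarith)) (decay₂_smul p3 (-1))

end Literature.MathematicalPhysics.QuantumFieldTheory.Balaban1983to89.Beta.RemainderKernelDecay
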